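import Mathlib
import Summits.KontsevichZagierPeriods.Zeta5Search.LeadingDigitSeries
import HarnessLib

/-!
# ζ(5) search — THEOREM B (the leading `p`-adic digit of the partial-fraction coefficients) is a THEOREM

Cell `pub-zeta5` (HONEST FRAMING: systematic search; no irrationality claim unless certified), typer seat
generation 8.  Discharges BY NAME gen-2 g6's THEOREM B (`ClusterValuation.LeadingDigit`, REPORT-gen2-g6 §2/§4a, g7 §2.3;
g8 re-check 13,052 instances): in the window `p² > b₀ + 2`, `p ≥ 5`, for a pole `q` of `R_b` of order `n_q = −netExp q`
and `1 ≤ σ ≤ n_q`,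
`c_{σ−1,q} = (−p)^{σ + E_x} · ( ĝ_q · ρ_{q,σ} + O(p) )`,
i.e. `v_p( c_{σ−1,q} − (−p)^{σ+E_x} ĝ_q ρ_{q,σ} ) ≥ σ + E_x + 1`, with gen-2's unit `ĝ_q` (`gHat`) and class cofactor
coefficient `ρ_{q,σ}` (`classRho`).

PROOF.  `c_{σ−1,q} = [X^κ] Gser b q` with `κ = n_q − σ` (`pf_eq_coeff_Gser`); `Gser = Gnear · Gfar` (part 1); the far part is
`p`-integral with constant term EXACTLY `ĝ_q` (`constantCoeff_Gfar`), so `Gfar − ĝ_q` has slope-`1` offset `1`; the near part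
has slope-`1` offset `E_x − netExp q` and, rescaled by `−p`, IS `(−p)^{E_x − netExp q} · classCofactor` (`rescale_Gnear`), so
`[X^κ] Gnear = (−p)^{σ+E_x} ρ_{q,σ}` exactly; the cross term `Gnear·(Gfar − ĝ_q)` has offset `E_x − netExp q + 1`, whence the
error bound.  Independent exact check of the statement as typed against this route: HOME/code/typer/g8_thmB_check.py
(3,090 instances, 0 failures).  Identities of rational numbers; nothing about irrationality.
-/

noncomputable section

open Finset PowerSeries

namespace Summit.KontsevichZagierPeriods.Zeta5Search.ClusterValuation

open Summit.KontsevichZagierPeriods.Zeta5Search.DualSeries (InBox)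
open Summit.KontsevichZagierPeriods.Zeta5Search.WedgeDictionary (pfData)
open Summit.KontsevichZagierPeriods.Zeta5Search.CasoratianValuation (InPolytope)
open Summit.KontsevichZagierPeriods.Zeta5Search.PadicSeries

variable {p : ℕ} [hp : Fact p.Prime]

/-! ### The far part: `p`-integral with constant term `ĝ_q` -/

/-- A far factor (`s ≢ q`) is `p`-integral. -/
theorem factorS_far_integral (b : ℕ → ℤ) {q s : ℕ} (hs : s ≤ (b 0).toNat) (hq : q ≤ (b 0).toNat) (hsq : s ≠ q)
    (hn : (b 0).toNat < p ^ 2) (hfar : ¬ (p : ℤ) ∣ (s : ℤ) - q) : CoeffBound p 0 0 (factorS b q s) := by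
  have hδ : ((s : ℚ) - q) ≠ 0 := sub_ne_zero.2 (by exact_mod_cast hsq)
  have hexact : padicNorm p ((s : ℚ) - q) = (p : ℚ) ^ (-(0 : ℤ)) := by
    have := padicNorm_sub_eq (p := p) hs hq hsq hn
    simpa [hfar] using this
  have hlin : CoeffBound p 0 0 (linS ((s : ℚ) - q)) := coeffBound_X_add_C le_rfl hexact.le
  have h0 : padicNorm p (coeff 0 (linS ((s : ℚ) - q) ^ 6)) = (p : ℚ) ^ (-((6 : ℕ) * (0 : ℤ))) :=
    padicNorm_coeff_zero_pow (by rw [coeff_zero_linS]; exact hexact) 6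
  have hinv := (hlin.pow 6).of_mul_eq_one h0 (PowerSeries.mul_inv_cancel _
    (by rw [constantCoeff_linS_pow]; exact pow_ne_zero _ hδ))
  simpa [factorS] using (hlin.pow (mult b s)).mul hinv

/-- The far part is `p`-integral. -/
theorem Gfar_integral (b : ℕ → ℤ) {q : ℕ} (hq : q ≤ (b 0).toNat) (hn : (b 0).toNat < p ^ 2) (hp2 : p ≠ 2) :
    CoeffBound p 0 0 (Gfar b p q) := by
  have h2 : padicNorm p (2 : ℚ) ≤ (p : ℚ) ^ (-(0 : ℤ)) := by simpa using padicNorm.of_nat (p := p) 2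
  have hcenP : CoeffBound p 0 0 (cenP b q : PowerSeries ℚ) := by
    unfold cenP
    split_ifs with hev
    · rw [Polynomial.coe_C]; exact coeffBound_C h2
    · rw [Polynomial.coe_add, Polynomial.coe_mul, Polynomial.coe_C, Polynomial.coe_X, Polynomial.coe_C]
      refine coeffBound_two_X_add_C le_rfl hp2 ?_
      have hz : ((((b 0).toNat : ℕ) : ℚ) - 2 * q) = ((((b 0).toNat : ℤ) - 2 * q : ℤ) : ℚ) := by push_cast; ring
      rw [hz, neg_zero, zpow_zero]; exact padicNorm.of_int _
  have hcen : CoeffBound p 0 0 (if ¬ (2 : ℤ) ∣ b 0 ∧ CentreIn b p q then C 2 else (cenP b q : PowerSeries ℚ)) := by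
    split_ifs
    · exact coeffBound_C h2
    · exact hcenP
  have hprod : CoeffBound p 0 (∑ _s ∈ ((range ((b 0).toNat + 1)).erase q).filter
      (fun s : ℕ => ¬ (p : ℤ) ∣ (s : ℤ) - q), (0 : ℤ))
      (∏ s ∈ ((range ((b 0).toNat + 1)).erase q).filter (fun s : ℕ => ¬ (p : ℤ) ∣ (s : ℤ) - q), factorS b q s) := by
    refine CoeffBound.prod _ _ _ fun s hs => ?_
    obtain ⟨hs1, hfar⟩ := mem_filter.1 hs
    have hs' := mem_erase.1 hs1
    exact factorS_far_integral b (Nat.lt_succ_iff.1 (mem_range.1 hs'.2)) hq hs'.1 hn hfar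
  have h := hcen.mul hprod
  unfold Gfar
  simpa using h

omit hp in
/-- Constant term of one factor: `(s − q)^{netExp s}`. -/
theorem constantCoeff_factorS (b : ℕ → ℤ) {q s : ℕ} (hsq : s ≠ q) :
    constantCoeff (factorS b q s) = ((s : ℚ) - q) ^ netExp b s := by
  have hδ : ((s : ℚ) - q) ≠ 0 := sub_ne_zero.2 (by exact_mod_cast hsq)
  have hm : netExp b s = (mult b s : ℤ) - 6 := by rw [mult_eq_netExp]; ring
  rw [factorS, map_mul, PowerSeries.constantCoeff_inv, constantCoeff_linS_pow, constantCoeff_linS_pow, hm,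
    zpow_sub₀ hδ, zpow_natCast, zpow_ofNat, div_eq_mul_inv]

omit hp in
/-- The far positions as a `Finset`: `{s ≤ b₀ : s ≢ q}` in the statement file's form. -/
theorem farSet_eq (b : ℕ → ℤ) {q : ℕ} (hq : q ≤ (b 0).toNat) :
    (range ((b 0).toNat + 1)).filter (fun s => s % p ≠ q % p) =
      ((range ((b 0).toNat + 1)).erase q).filter (fun s : ℕ => ¬ (p : ℤ) ∣ (s : ℤ) - q) := by
  ext s
  simp only [mem_filter, mem_erase, mem_range]
  have hiff : (p : ℤ) ∣ (s : ℤ) - q ↔ s % p = q % p := by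
    rw [dvd_sub_comm]; exact (Nat.modEq_iff_dvd).symm
  rw [hiff]
  constructor
  · rintro ⟨hs, hne⟩
    exact ⟨⟨by rintro rfl; exact hne rfl, hs⟩, hne⟩
  · rintro ⟨⟨_, hs⟩, hne⟩
    exact ⟨hs, hne⟩

omit hp in
/-- **The constant term of the far part is gen-2's unit `ĝ_q`.** -/
theorem constantCoeff_Gfar (b : ℕ → ℤ) (h0 : 0 ≤ b 0) {q : ℕ} (hq : q ≤ (b 0).toNat) :
    constantCoeff (Gfar b p q) = gHat b p q := by
  have hb0 : ((((b 0).toNat : ℕ) : ℚ)) = ((b 0 : ℤ) : ℚ) := by exact_mod_cast Int.toNat_of_nonneg h0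
  have hprod : constantCoeff (∏ s ∈ ((range ((b 0).toNat + 1)).erase q).filter
      (fun s : ℕ => ¬ (p : ℤ) ∣ (s : ℤ) - q), factorS b q s) =
      ∏ s ∈ (range ((b 0).toNat + 1)).filter (fun s => s % p ≠ q % p), ((s : ℚ) - q) ^ netExp b s := by
    rw [map_prod, farSet_eq b hq]
    refine prod_congr rfl fun s hs => constantCoeff_factorS b (mem_erase.1 (mem_filter.1 hs).1).1
  rw [Gfar, map_mul, hprod, gHat]
  by_cases hc : ¬ (2 : ℤ) ∣ b 0 ∧ CentreIn b p q
  · rw [if_pos hc, if_neg (fun h => h.2 hc.2), constantCoeff_C]; ring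
  · rw [if_neg hc]
    by_cases hev : (2 : ℤ) ∣ b 0
    · rw [if_neg (fun h => h.1 hev), cenP, if_pos hev, Polynomial.coe_C, constantCoeff_C]; ring
    · have hnc : ¬ CentreIn b p q := fun h => hc ⟨hev, h⟩
      rw [if_pos ⟨hev, hnc⟩, cenP, if_neg hev, Polynomial.coe_add, Polynomial.coe_mul, Polynomial.coe_C,
        Polynomial.coe_X, Polynomial.coe_C, map_add, map_mul, constantCoeff_C, constantCoeff_X, constantCoeff_C, hb0]
      ring

/-- `Gfar − ĝ_q` has slope-`1` offset `1` (zero constant term, integral coefficients). -/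
theorem Gfar_sub_bound (b : ℕ → ℤ) (h0 : 0 ≤ b 0) {q : ℕ} (hq : q ≤ (b 0).toNat) (hn : (b 0).toNat < p ^ 2)
    (hp2 : p ≠ 2) : CoeffBound p 1 1 (Gfar b p q - C (gHat b p q)) := by
  intro k
  rw [map_sub, coeff_C]
  rcases Nat.eq_zero_or_pos k with rfl | hk
  · rw [if_pos rfl, coeff_zero_eq_constantCoeff_apply, constantCoeff_Gfar b h0 hq, sub_self, padicNorm.zero]
    exact zpow_p_nonneg _
  · rw [if_neg (by omega), sub_zero]
    refine ((Gfar_integral b hq hn hp2) k).trans (zpow_le_zpow_right₀ one_le_p ?_)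
    omega

/-! ### The near part: slope-`1` offset `E_x − netExp q` -/

/-- The near part has slope-`1` offset `classExp q − netExp q`. -/
theorem Gnear_bound (b : ℕ → ℤ) (h0 : 0 ≤ b 0) {q : ℕ} (hq : q ≤ (b 0).toNat) (hn : (b 0).toNat < p ^ 2)
    (hp2 : p ≠ 2) : CoeffBound p 1 (classExp b p q - netExp b q) (Gnear b p q) := by
  have hb0 : ((((b 0).toNat : ℕ) : ℤ)) = b 0 := Int.toNat_of_nonneg h0
  have hprod : CoeffBound p 1 (∑ s ∈ (classSet b p q).erase q, netExp b s)
      (∏ s ∈ (classSet b p q).erase q, factorS b q s) := by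
    refine CoeffBound.prod _ _ _ fun s hs => ?_
    have hs' : s ∈ ((range ((b 0).toNat + 1)).erase q).filter (fun s : ℕ => (p : ℤ) ∣ (s : ℤ) - q) := by
      rw [filter_dvd_eq_classSet_erase]; exact hs
    obtain ⟨hs1, hdvd⟩ := mem_filter.1 hs'
    have hs2 := mem_erase.1 hs1
    have h := factor_bound b (Nat.lt_succ_iff.1 (mem_range.1 hs2.2)) hq hs2.1 hn
    rw [if_pos hdvd] at h
    exact h
  have hcen : CoeffBound p 1 (if ¬ (2 : ℤ) ∣ b 0 ∧ CentreIn b p q then 1 else 0)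
      (if ¬ (2 : ℤ) ∣ b 0 ∧ CentreIn b p q then linS ((((b 0).toNat : ℕ) : ℚ) / 2 - q) else 1) := by
    split_ifs with hc
    · refine coeffBound_X_add_C le_rfl ?_
      -- `‖b₀/2 − q‖_p = ‖b₀ − 2q‖_p ≤ p^{-1}`
      obtain ⟨m, hm⟩ := hc.2
      have hval : ((((b 0).toNat : ℕ) : ℚ) / 2 - q) = ((-(p : ℤ) * m : ℤ) : ℚ) / 2 := by
        have : ((((b 0).toNat : ℕ) : ℚ)) - 2 * q = ((-(p : ℤ) * m : ℤ) : ℚ) := by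
          have e : (((b 0).toNat : ℕ) : ℤ) - 2 * q = -(p : ℤ) * m := by rw [hb0]; linarith
          exact_mod_cast e
        linarith
      rw [hval, padicNorm.div]
      have h2 : padicNorm p (2 : ℚ) = 1 := by
        have := (padicNorm.nat_eq_one_iff (p := p) 2).2 (by
          intro h; exact hp2 ((Nat.prime_dvd_prime_iff_eq hp.out Nat.prime_two).1 h))
        exact_mod_cast this
      rw [h2, div_one]
      exact padicNorm.dvd_iff_norm_le.1 (by simp)
    · simpa using (coeffBound_one : CoeffBound p 1 0 1)
  have h := hcen.mul hprod
  rw [← nearExp_eq b hq, add_comm]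
  exact h

/-! ### Theorem B -/

/-- **THEOREM B (leading digit) is a theorem.** -/
theorem leadingDigit_holds : LeadingDigit := by
  intro b p q σ hb hprime hp5 hwin hq hσ1 hσ hne
  haveI : Fact p.Prime := ⟨hprime⟩
  obtain ⟨hbox, hhalf, hpf, hn⟩ := thmA_data b hb hwin
  have h0 : 0 ≤ b 0 := hbox.1
  have hp2 : p ≠ 2 := by omega
  have hp0 : p ≠ 0 := hprime.ne_zero
  have hp' : (-(p : ℚ)) ≠ 0 := neg_ne_zero.2 (Nat.cast_ne_zero.2 hp0)
  have hm := mult_eq_netExp b q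
  -- the coefficient as a coefficient of `Gser`
  have hid := pf_eq_coeff_Gser b hbox hhalf hpf hq (show σ - 1 < 6 by omega)
  rw [coeff_X_pow_mul', if_pos (by omega)] at hid
  set κ := 5 - (σ - 1) - mult b q with hκ
  have hκZ : (κ : ℤ) = -netExp b q - σ := by omega
  have hκN : (-netExp b q).toNat - σ = κ := by omega
  -- split `Gser = Gnear·ĝ + Gnear·(Gfar − ĝ)`
  have hsplit : Gser b q = Gnear b p q * C (gHat b p q) + Gnear b p q * (Gfar b p q - C (gHat b p q)) := by
    rw [Gser_eq_near_mul_far b p q]; ring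
  -- the exact leading term
  have hlead : coeff κ (Gnear b p q * C (gHat b p q)) =
      (-(p : ℚ)) ^ ((σ : ℤ) + classExp b p q) * gHat b p q * classRho b p q σ := by
    have hres := congrArg (coeff κ) (rescale_Gnear hp0 b h0 hq)
    rw [coeff_rescale, coeff_C_mul] at hres
    -- hres : (-p)^κ * coeff κ Gnear = (-p)^(E - e_q) * coeff κ classCofactor
    have hG : coeff κ (Gnear b p q) =
        (-(p : ℚ)) ^ ((σ : ℤ) + classExp b p q) * coeff κ (classCofactor b p q) := by
      have e1 : (-(p : ℚ)) ^ κ = (-(p : ℚ)) ^ (κ : ℤ) := (zpow_natCast _ _).symm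
      rw [e1] at hres
      have hκ0 : (-(p : ℚ)) ^ (κ : ℤ) ≠ 0 := zpow_ne_zero _ hp'
      rw [← mul_right_inj' hκ0, hres, ← mul_assoc, ← zpow_add₀ hp']
      congr 2; omega
    rw [coeff_mul_C, hG, classRho, hκN]; ring
  -- the error term
  have herr : CoeffBound p 1 (classExp b p q - netExp b q + 1)
      (Gnear b p q * (Gfar b p q - C (gHat b p q))) :=
    (Gnear_bound b h0 hq hn hp2).mul (Gfar_sub_bound b h0 hq hn hp2)
  have hdiff : pfData b (σ - 1) q - (-(p : ℚ)) ^ ((σ : ℤ) + classExp b p q) * gHat b p q * classRho b p q σ =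
      coeff κ (Gnear b p q * (Gfar b p q - C (gHat b p q))) := by
    rw [hid, hsplit, map_add, hlead]; ring
  rw [hdiff] at hne ⊢
  have hv := herr.le_padicValRat hne
  rw [hκZ] at hv
  linarith

end Summit.KontsevichZagierPeriods.Zeta5Search.ClusterValuation

end
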